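import Literature.Computability.QuantumComplexity.SubsampledMatrixProduct
import HarnessLib

/-!
# Closure properties of oversampling and query access: matrices, outer products, linear
# combinations, and approximate matrix products (CGLLTW 2022, §2.2 and Remark 3.1)

Chia, Gilyén, Li, Lin, Tang, Wang, *Sampling-based sublinear low-rank matrix arithmetic framework
for dequantizing quantum machine learning*, J. ACM 69(5):33 (2022) = arXiv:1910.06151 (numbering
and wording of the held arXiv text), **§2.2 "Sampling and query access oracles"** — Definition 2.9
and the two unnumbered lemmas after it — and **§3.2 "Technical tools", Remark 3.1**:

> **Definition 2.9 (Oversampling and query access to a matrix).** For a matrix `A ∈ ℂ^{m×n}`, we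
> have `SQ(A)` if we have `SQ(A(i,·))` for all `i ∈ [m]` and `SQ(a)` for `a ∈ ℝ^m` the vector of
> row norms (`a(i) := ‖A(i,·)‖`). We have `SQ_φ(A)` if we have `Q(A)` and `SQ(Ã)` for `Ã ∈ ℂ^{m×n}`
> satisfying `‖Ã‖_F² = φ‖A‖_F²` and `|Ã(i,j)|² ≥ |A(i,j)|²` for all `(i,j) ∈ [m]×[n]`.
>
> **Lemma (outer products).** Given vectors `u ∈ ℂ^m, v ∈ ℂ^n` with `SQ_{φ_u}(u), SQ_{φ_v}(v)`
> access we have `SQ_φ(A)` for their outer product `A := u v†` with `φ = φ_u φ_v` and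
> `s_φ(A) = s_{φ_u}(u) + s_{φ_v}(v)`, `q_φ(A) = q_{φ_u}(u) + q_{φ_v}(v)`, `q(A) = q(u) + q(v)`, and
> `n_φ(A) = n_{φ_u}(u) + n_{φ_v}(v)`.
>
> **Lemma (linear combinations of matrices).** Given `SQ_{φ^{(1)}}(A^{(1)}), …, SQ_{φ^{(τ)}}(A^{(τ)})
> ∈ ℂ^{m×n}`, we have `SQ_φ(A) ∈ ℂ^{m×n}` for `A := Σ_{t=1}^τ λ_t A^{(t)}` with
> `φ = τ (Σ_{t=1}^τ φ^{(t)}‖λ_t A^{(t)}‖_F²)/‖A‖_F²` and `s_φ(A) = max_t s_{φ^{(t)}}(A^{(t)}) +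
> Σ_t q_{φ^{(t)}}(A^{(t)})`, `q_φ(A) = Σ_t q_{φ^{(t)}}(A^{(t)})`, `q(A) = Σ_t q(A^{(t)})`, and
> `n_φ(A) = 1` (after paying `Σ_t n_{φ^{(t)}}(A^{(t)})` one-time pre-processing cost).
>
> **Remark 3.1.** Lemma "Approximating matrix multiplication to Frobenius norm error" implies
> that, given `SQ_{φ₁}(X)` and `SQ_{φ₂}(Y)`, we can get `SQ_φ(M)` for `M` a sufficiently good
> approximation to `X†Y`, with `φ ≤ φ₁φ₂ ‖X‖_F²‖Y‖_F²/‖M‖_F²`. This is an approximate closure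
> property for oversampling and query access under matrix products.
>
> Given the above types of accesses, we can compute the sketch `S` necessary for the Lemma by
> taking `p = 𝒟_x̃` and `q = 𝒟_ỹ`, thereby finding a desired `M := X†S†SY`. We can compute entries
> of `M` with only `s` queries each to `X` and `Y`, so all we need is to get `SQ(M̃)` for `M̃` the
> appropriate bound. We choose `|M̃(i,j)|² := s Σ_{ℓ=1}^s |[SX̃](ℓ,i)†[SỸ](ℓ,j)|²`; showing that we
> have `SQ(M̃)` follows from the proofs of the two Lemmas above, since `M̃` is simply a linear
> combination of outer products of rows of `X̃` with rows of `Ỹ`. Finally, this bound has the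
> appropriate norm. Notating the rows sampled by the sketch as `k_1, …, k_s`, we have
> `‖M̃‖_F² = s Σ_ℓ ‖[SX̃](ℓ,·)‖²‖[SỸ](ℓ,·)‖²
>  = s Σ_ℓ 4‖X̃(k_ℓ,·)‖²‖Ỹ(k_ℓ,·)‖² / (s²(‖X̃(k_ℓ,·)‖²/‖X̃‖_F² + ‖Ỹ(k_ℓ,·)‖²/‖Ỹ‖_F²)²)
>  ≤ Σ_ℓ 4‖X̃(k_ℓ,·)‖²‖Ỹ(k_ℓ,·)‖² / (s(2‖X̃(k_ℓ,·)‖‖Ỹ(k_ℓ,·)‖/(‖X̃‖_F‖Ỹ‖_F))²) = ‖X̃‖_F²‖Ỹ‖_F²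
>  = φ₁φ₂‖X‖_F²‖Y‖_F²`.

What is formalized (the MATHEMATICAL content; oracle costs `s, q, n` are bookkeeping and are not
modelled, exactly as in `SampleQueryAccess.lean`), in the order of the text:

* Def. 2.9: `MatrixOversamplingWitness φ A` = the data `Ã` with `‖Ã‖_F² = φ‖A‖_F²` and entrywise
  `A(i,j)² ≤ Ã(i,j)²`; proved: `SQ₁(A) = SQ(A)` (`refl`), row and Frobenius domination, `φ ≥ 1`
  for `A ≠ 0`, and the sentence of §2.3 that the row-norm distribution `𝒟_ã` coming from `SQ_φ(A)`
  is a `φ`-oversampled importance sampling distribution of `a` (`isOversampledDist_rowDist` — the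
  hypothesis under which `ApproxMatrixProduct.lean` / `SubsampledMatrixProduct.lean` are stated),
  together with the "`SQ_φ(A)` implies `SQ_φ(vec A)`" inequality (`vec_div_le`);
* Lemma "outer products": `ũ ṽᵀ` is a witness for `u vᵀ` with `φ = φ_u φ_v`
  (`OversamplingWitness.outer`), and the two sampling identities behind
  `s_φ(A) = s_{φ_u}(u) + s_{φ_v}(v)`: the row-norm distribution of `ũṽᵀ` is `𝒟_ũ` and every
  nonzero row of it has distribution `𝒟_ṽ` (`rowDist_vecMulVec`, `lengthSqDist_vecMulVec_row`);
* Lemma "linear combinations of matrices": `Ã(i,j) = √(τ Σ_t λ_t² Ã^{(t)}(i,j)²)`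
  (`mlinCombTilde`) dominates `Σ_t λ_t A^{(t)}` entrywise (Cauchy–Schwarz,
  `sq_sum_le_mlinCombTilde_sq`) and has `‖Ã‖_F² = τ Σ_t φ^{(t)}‖λ_t A^{(t)}‖_F²`
  (`frobSq_mlinCombTilde`), whence the witness `MatrixOversamplingWitness.linComb` with the printed
  `φ`; and the two mixture identities behind `s_φ(A)` (sample `t ∝ λ_t²‖Ã^{(t)}‖_F²`, then a row of
  `Ã^{(t)}`; within row `i`, sample `t ∝ λ_t²‖Ã^{(t)}(i,·)‖²`, then from `Ã^{(t)}(i,·)`):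
  `rowDist_mlinCombTilde_mixture`, `lengthSqDist_mlinCombTilde_row_mixture`;
* Remark 3.1: with `r = (𝒟_x̃ + 𝒟_ỹ)/2` (`avgDist`; `x̃, ỹ` the row-norm vectors of `X̃, Ỹ`),
  `S` the sketch sampled according to `r` along `ω ∈ [m]^s`, `M = (SX)ᵀ(SY)` (`approxProd`) and
  `M̃(i,j) = √(s Σ_ℓ [SX̃](ℓ,i)²[SỸ](ℓ,j)²)` (`approxProdTilde`, literally `mlinCombTilde` of the
  `s` outer products `[SX̃](ℓ,·)[SỸ](ℓ,·)ᵀ` with coefficients `1`): `M` is the corresponding linear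
  combination of the outer products `[SX](ℓ,·)[SY](ℓ,·)ᵀ` (`approxProd_eq_sum_vecMulVec`),
  `M(i,j)² ≤ M̃(i,j)²` (`approxProd_sq_le`), the displayed computation
  `‖M̃‖_F² = s Σ_ℓ ‖[SX̃](ℓ,·)‖²‖[SỸ](ℓ,·)‖²` (`frobSq_approxProdTilde`) `≤ ‖X̃‖_F²‖Ỹ‖_F²`
  (AM–GM per sampled row, `sketch_row_term_le`; `frobSq_approxProdTilde_le`) `= φ₁φ₂‖X‖_F²‖Y‖_F²`
  (`frobSq_approxProdTilde_le'`), the witness `approxProdWitness` for `M ≠ 0` with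
  `φ = ‖M̃‖_F²/‖M‖_F² ≤ φ₁φ₂‖X‖_F²‖Y‖_F²/‖M‖_F²` (`approxProd_phi_le`), the sampling structure of
  `M̃` (`rowDist_approxProdTilde_mixture`, `lengthSqDist_approxProdTilde_row_mixture`,
  `lengthSqDist_sketch_mul_row`: the sketched rows have the distributions of the sampled rows of
  `X̃`, `Ỹ`), and the Remark assembled with the key lemma of `SubsampledMatrixProduct.lean`
  (`approx_matrix_product'`): for every `δ > 0`, outside a set of sample sequences of `r`-mass
  `< δ`, `‖M − XᵀY‖_F < √(8φ₁φ₂ log(2/δ)/s)‖X‖_F‖Y‖_F`, while for EVERY sample sequence `M̃`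
  dominates `M` with `‖M̃‖_F² ≤ φ₁φ₂‖X‖_F²‖Y‖_F²` (`approxProd_closure`).

Conventions as in `SampleQueryAccess.lean` / `ApproxMatrixProduct.lean`: real entries
(`-- TODO(general form): RCLike entries`; every quantity depends on entries only through squares
of products), `Matrix (Fin m) (Fin n) ℝ` with `A i` the `i`-th row, `X†Y = Xᵀ * Y`, the outer
product `u v†` is `Matrix.vecMulVec u v`.  Division junk values (`x/0 = 0`): `rowDist 0` and
`lengthSqDist 0` are `0`, so the mixture identities carry the non-degeneracy hypotheses the text
leaves implicit, and the witness `φ = ‖M̃‖_F²/‖M‖_F²` needs `M ≠ 0` (for `M = 0` every `SQ_φ`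
statement about `M` is vacuous).  Remark 2.10 (`A†A` as `m` outer products,
`R†UR` as `r²` outer products — instances of the two lemmas) is the section `rur` at the end
(`gramWitness`, `rurWitness`).  Not formalized: the running-time sums, complex entries.  No named facts are
introduced; everything stated is proved.

## References
* [ChiaEtAl2022] N.-H. Chia, A. Gilyén, T. Li, H.-H. Lin, E. Tang, C. Wang, J. ACM 69(5):33, 2022,
  doi:10.1145/3549524 (= STOC 2020, doi:10.1145/3357713.3384314; arXiv:1910.06151) — §2.2
  Def. 2.9, Lemma "outer products" (`lem:outersampling`), Lemma "linear combinations of matrices"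
  (`lem:wosampling`) (held text p. 14–15); §3.2 Remark 3.1 and the paragraph after it (held text
  p. 18 L81–83, p. 19 L1–13).
* [TangEwin2019] E. Tang, STOC 2019, doi:10.1145/3313276.3316310, Prop. 4.3 (the vector case of
  the linear-combination lemma, `SampleQueryAccess.lean`).
-/

noncomputable section

namespace Literature.Computability.QuantumComplexity

namespace SampleQuery

open Finset

open scoped Matrix

variable {m n q : ℕ}

/-! ### Definition 2.9: oversampling and query access to a matrix -/

/-- The data of `SQ_φ(A)` beyond query access to `A`: an entrywise dominating matrix `Ã` with
`‖Ã‖_F² = φ‖A‖_F²` and `|Ã(i,j)|² ≥ |A(i,j)|²`, to which one has `SQ` access (rows and row-norm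
vector). [cite: ChiaEtAl2022, Def. 2.9] -/
structure MatrixOversamplingWitness (φ : ℝ) (A : Matrix (Fin m) (Fin n) ℝ) where
  /-- the dominating matrix `Ã` -/
  tilde : Matrix (Fin m) (Fin n) ℝ
  /-- `‖Ã‖_F² = φ ‖A‖_F²` -/
  frobSq_tilde : frobSq tilde = φ * frobSq A
  /-- `|Ã(i,j)|² ≥ |A(i,j)|²` -/
  sq_le : ∀ i j, A i j ^ 2 ≤ tilde i j ^ 2

/-- `‖cA‖_F² = c²‖A‖_F²`. [cite: ChiaEtAl2022, §2.1 notation] -/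
theorem frobSq_smul (c : ℝ) (A : Matrix (Fin m) (Fin n) ℝ) : frobSq (c • A) = c ^ 2 * frobSq A := by
  simp only [frobSq_eq_sum_sq, Matrix.smul_apply, smul_eq_mul, mul_pow, Finset.mul_sum]

namespace MatrixOversamplingWitness

variable {φ : ℝ} {A : Matrix (Fin m) (Fin n) ℝ}

/-- "We omit subscripts if `φ = 1`": `SQ₁(A) = SQ(A)` with `Ã = A`. [cite: ChiaEtAl2022, Def. 2.9] -/
def refl (A : Matrix (Fin m) (Fin n) ℝ) : MatrixOversamplingWitness 1 A where
  tilde := A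
  frobSq_tilde := by rw [one_mul]
  sq_le _ _ := le_rfl

/-- The witness of `SQ₁(A) = SQ(A)` is `A` itself. [cite: ChiaEtAl2022, Def. 2.9] -/
@[simp] theorem refl_tilde (A : Matrix (Fin m) (Fin n) ℝ) : (refl A).tilde = A := rfl

/-- Row domination `‖A(i,·)‖² ≤ ‖Ã(i,·)‖²` (sum the entrywise domination over the row).
[cite: ChiaEtAl2022, Def. 2.9] -/
theorem normSq_row_le (W : MatrixOversamplingWitness φ A) (i : Fin m) :
    normSq (A i) ≤ normSq (W.tilde i) :=
  sum_le_sum fun j _ => W.sq_le i j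

/-- `‖A‖_F² ≤ ‖Ã‖_F²`. [cite: ChiaEtAl2022, Def. 2.9] -/
theorem frobSq_le (W : MatrixOversamplingWitness φ A) : frobSq A ≤ frobSq W.tilde :=
  sum_le_sum fun i _ => W.normSq_row_le i

/-- A witness of a nonzero matrix has `φ ≥ 1`. [cite: ChiaEtAl2022, Def. 2.9 with Def. 2.7
("for `φ ≥ 1`")] -/
theorem one_le (W : MatrixOversamplingWitness φ A) (hA : A ≠ 0) : 1 ≤ φ := by
  have h := W.frobSq_le
  rw [W.frobSq_tilde] at h
  exact (le_mul_iff_one_le_left (frobSq_pos hA)).1 h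

/-- `φ > 0` for a witness of a nonzero matrix. [cite: ChiaEtAl2022, Def. 2.9] -/
theorem pos (W : MatrixOversamplingWitness φ A) (hA : A ≠ 0) : 0 < φ :=
  lt_of_lt_of_le one_pos (W.one_le hA)

/-- The dominating matrix of a nonzero matrix is nonzero. [cite: ChiaEtAl2022, Def. 2.9] -/
theorem tilde_ne_zero (W : MatrixOversamplingWitness φ A) (hA : A ≠ 0) : W.tilde ≠ 0 := by
  intro h
  have := W.frobSq_le
  rw [h] at this
  have h0 : frobSq (0 : Matrix (Fin m) (Fin n) ℝ) = 0 := by simp [frobSq_eq_sum_sq]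
  rw [h0] at this
  exact absurd this (not_le.2 (frobSq_pos hA))

/-- `‖Ã‖_F² > 0` for a witness of a nonzero matrix. [cite: ChiaEtAl2022, Def. 2.9] -/
theorem frobSq_tilde_pos (W : MatrixOversamplingWitness φ A) (hA : A ≠ 0) : 0 < frobSq W.tilde :=
  frobSq_pos (W.tilde_ne_zero hA)

/-- **`SQ_φ(A)` supplies `φ`-oversampled importance sampling sketches**: the row-norm distribution
`𝒟_ã(k) = ‖Ã(k,·)‖²/‖Ã‖_F²` available under `SQ_φ(A)` is a `φ`-oversampled importance sampling
distribution of the row-norm vector `a` of `A` ("we call them `φ`-oversampled importance sampling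
sketches if `p` comes from `SQ_φ(A)`"). [cite: ChiaEtAl2022, §2.3, sentence after Def. 2.12;
Def. 2.9 with Def. 2.7] -/
theorem isOversampledDist_rowDist (W : MatrixOversamplingWitness φ A) (hA : A ≠ 0) :
    IsOversampledDist φ (rowNorms A) (rowDist W.tilde) := by
  have hF : 0 < frobSq A := frobSq_pos hA
  have hFt : 0 < frobSq W.tilde := W.frobSq_tilde_pos hA
  have hφ : 0 < φ := W.pos hA
  refine ⟨fun k => div_nonneg (normSq_nonneg _) hFt.le, ?_, fun k => ?_⟩
  · unfold rowDist
    rw [← Finset.sum_div]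
    exact div_self hFt.ne'
  · rw [lengthSqDist_rowNorms]
    unfold rowDist
    rw [W.frobSq_tilde, div_div, mul_comm (frobSq A)]
    exact div_le_div_of_nonneg_right (W.normSq_row_le k) (mul_pos hφ hF).le

/-- **"`SQ_φ(A)` implies `SQ_φ(vec A)`"**: the two-stage sample `i ∼ 𝒟_ã`, `j ∼ 𝒟_{Ã(i,·)}` hits
`(i,j)` with probability `Ã(i,j)²/‖Ã‖_F² ≥ (A(i,j)²/‖A‖_F²)/φ`, i.e. it `φ`-oversamples
`𝒟_{vec A}`. [cite: ChiaEtAl2022, §2.2, paragraph after Def. 2.9] -/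
theorem vec_div_le (W : MatrixOversamplingWitness φ A) (hA : A ≠ 0) (i : Fin m) (j : Fin n) :
    A i j ^ 2 / frobSq A / φ ≤ rowDist W.tilde i * lengthSqDist (W.tilde i) j := by
  rw [rowDist_mul_lengthSqDist, W.frobSq_tilde, div_div, mul_comm (frobSq A)]
  exact div_le_div_of_nonneg_right (W.sq_le i j) (mul_pos (W.pos hA) (frobSq_pos hA)).le

end MatrixOversamplingWitness

/-! ### Lemma "outer products" (`lem:outersampling`) -/

section outer

variable (a : Fin m → ℝ) (b : Fin n → ℝ)

/-- Entries of the outer product squared: `(u v†)(i,j)² = u(i)² v(j)²`.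
[cite: ChiaEtAl2022, §2.2 Lemma "outer products"] -/
theorem vecMulVec_sq (i : Fin m) (j : Fin n) :
    Matrix.vecMulVec a b i j ^ 2 = a i ^ 2 * b j ^ 2 := by
  rw [Matrix.vecMulVec_apply, mul_pow]

/-- Row `i` of `u v†` is `u(i)·v`, of squared norm `u(i)²‖v‖²`.
[cite: ChiaEtAl2022, §2.2 Lemma "outer products"] -/
theorem normSq_vecMulVec_row (i : Fin m) :
    normSq (Matrix.vecMulVec a b i) = a i ^ 2 * normSq b := by
  unfold normSq
  simp_rw [vecMulVec_sq]
  rw [Finset.mul_sum]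

/-- `‖u v†‖_F² = ‖u‖²‖v‖²`. [cite: ChiaEtAl2022, §2.2 Lemma "outer products"] -/
theorem frobSq_vecMulVec : frobSq (Matrix.vecMulVec a b) = normSq a * normSq b := by
  unfold frobSq
  simp_rw [normSq_vecMulVec_row]
  rw [← Finset.sum_mul]
  rfl

/-- **Sampling the row-norm vector of an outer product = sampling `u`**: for `v ≠ 0` the row
distribution of `u v†` is `𝒟_u` (so `SQ` of the row-norm vector of `ũṽ†` costs one sample of `ũ`).
[cite: ChiaEtAl2022, §2.2 Lemma "outer products" (`s_φ(A) = s_{φ_u}(u) + s_{φ_v}(v)`)] -/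
theorem rowDist_vecMulVec (hb : b ≠ 0) (i : Fin m) :
    rowDist (Matrix.vecMulVec a b) i = lengthSqDist a i := by
  unfold rowDist lengthSqDist
  rw [normSq_vecMulVec_row, frobSq_vecMulVec, mul_div_mul_right _ _ (normSq_pos hb).ne']

/-- **Sampling a row of an outer product = sampling `v`**: for `u(i) ≠ 0` the distribution of row
`i` of `u v†` is `𝒟_v`. [cite: ChiaEtAl2022, §2.2 Lemma "outer products"
(`s_φ(A) = s_{φ_u}(u) + s_{φ_v}(v)`)] -/
theorem lengthSqDist_vecMulVec_row {i : Fin m} (ha : a i ≠ 0) (j : Fin n) :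
    lengthSqDist (Matrix.vecMulVec a b i) j = lengthSqDist b j := by
  unfold lengthSqDist
  rw [normSq_vecMulVec_row, vecMulVec_sq, mul_div_mul_left _ _ (pow_ne_zero 2 ha)]

end outer

namespace OversamplingWitness

variable {φa φb : ℝ} {a : Fin m → ℝ} {b : Fin n → ℝ}

/-- **Outer products.** From `SQ_{φ_u}(u)` and `SQ_{φ_v}(v)`: `Ã := ũ ṽ†` is a witness for
`A := u v†` with `φ = φ_u φ_v` (`‖ũṽ†‖_F² = ‖ũ‖²‖ṽ‖² = φ_uφ_v‖u‖²‖v‖² = φ_uφ_v‖uv†‖_F²`, and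
`|ũ(i)ṽ(j)|² ≥ |u(i)v(j)|²`); queries `Ã(i,j) = ũ(i)ṽ(j)` cost one query to each factor.
[cite: ChiaEtAl2022, §2.2 Lemma "outer products"] -/
def outer (wa : OversamplingWitness φa a) (wb : OversamplingWitness φb b) :
    MatrixOversamplingWitness (φa * φb) (Matrix.vecMulVec a b) where
  tilde := Matrix.vecMulVec wa.tilde wb.tilde
  frobSq_tilde := by
    rw [frobSq_vecMulVec, frobSq_vecMulVec, wa.normSq_tilde, wb.normSq_tilde]; ring
  sq_le i j := by
    rw [vecMulVec_sq, vecMulVec_sq]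
    exact mul_le_mul (wa.sq_le i) (wb.sq_le j) (sq_nonneg _) (sq_nonneg _)

/-- The witness of the outer-product lemma is `ũ ṽ†`. [cite: ChiaEtAl2022, §2.2 Lemma "outer
products"] -/
@[simp] theorem outer_tilde (wa : OversamplingWitness φa a) (wb : OversamplingWitness φb b) :
    (outer wa wb).tilde = Matrix.vecMulVec wa.tilde wb.tilde := rfl

end OversamplingWitness

/-! ### Lemma "linear combinations of matrices" (`lem:wosampling`) -/

section mlinComb

variable {τ : ℕ}

/-- The dominating matrix for `Σ_t λ_t A^{(t)}` built from dominating matrices `Ã^{(t)}`: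
`Ã(i,j) = √(τ · Σ_t λ_t² Ã^{(t)}(i,j)²)` ("using the same ideas as in" the vector lemma, whose
witness is `ṽ(i) = √(k Σ_t λ_t² ṽ_t(i)²)`, `SampleQueryAccess.linCombTilde`).
[cite: ChiaEtAl2022, §2.2 Lemma "linear combinations of matrices"] -/
def mlinCombTilde (Ts : Fin τ → Matrix (Fin m) (Fin n) ℝ) (c : Fin τ → ℝ) :
    Matrix (Fin m) (Fin n) ℝ :=
  fun i j => Real.sqrt (τ * ∑ t, c t ^ 2 * Ts t i j ^ 2)

variable (Ts : Fin τ → Matrix (Fin m) (Fin n) ℝ) (c : Fin τ → ℝ)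

/-- `Ã(i,j)² = τ Σ_t λ_t² Ã^{(t)}(i,j)²`. [cite: ChiaEtAl2022, §2.2 Lemma "linear combinations of
matrices"] -/
theorem mlinCombTilde_sq (i : Fin m) (j : Fin n) :
    mlinCombTilde Ts c i j ^ 2 = τ * ∑ t, c t ^ 2 * Ts t i j ^ 2 :=
  Real.sq_sqrt (mul_nonneg (Nat.cast_nonneg τ)
    (sum_nonneg fun _ _ => mul_nonneg (sq_nonneg _) (sq_nonneg _)))

/-- Row norms of the dominating matrix: `‖Ã(i,·)‖² = τ Σ_t λ_t² ‖Ã^{(t)}(i,·)‖²`.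
[cite: ChiaEtAl2022, §2.2 Lemma "linear combinations of matrices"] -/
theorem normSq_mlinCombTilde_row (i : Fin m) :
    normSq (mlinCombTilde Ts c i) = τ * ∑ t, c t ^ 2 * normSq (Ts t i) := by
  unfold normSq
  simp_rw [mlinCombTilde_sq, Finset.mul_sum]
  rw [Finset.sum_comm]

/-- `‖Ã‖_F² = τ Σ_t λ_t² ‖Ã^{(t)}‖_F²`. [cite: ChiaEtAl2022, §2.2 Lemma "linear combinations of
matrices"] -/
theorem frobSq_mlinCombTilde :
    frobSq (mlinCombTilde Ts c) = τ * ∑ t, c t ^ 2 * frobSq (Ts t) := by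
  unfold frobSq
  simp_rw [normSq_mlinCombTilde_row, Finset.mul_sum]
  rw [Finset.sum_comm]

/-- Cauchy–Schwarz step: if `A^{(t)}(i,j)² ≤ Ã^{(t)}(i,j)²` for all `t`, then
`(Σ_t λ_t A^{(t)}(i,j))² ≤ τ Σ_t λ_t² Ã^{(t)}(i,j)² = Ã(i,j)²`. [cite: ChiaEtAl2022, §2.2 Lemma
"linear combinations of matrices" (proof: "the same ideas as in" the vector lemma)] -/
theorem sq_sum_le_mlinCombTilde_sq (As : Fin τ → Matrix (Fin m) (Fin n) ℝ)
    (hdom : ∀ t i j, As t i j ^ 2 ≤ Ts t i j ^ 2) (i : Fin m) (j : Fin n) :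
    (∑ t, c t * As t i j) ^ 2 ≤ mlinCombTilde Ts c i j ^ 2 := by
  rw [mlinCombTilde_sq]
  calc (∑ t, c t * As t i j) ^ 2 = (∑ t, (c t * As t i j) * 1) ^ 2 := by simp
    _ ≤ (∑ t, (c t * As t i j) ^ 2) * ∑ _t : Fin τ, (1 : ℝ) ^ 2 :=
        sum_mul_sq_le_sq_mul_sq _ _ _
    _ = τ * ∑ t, c t ^ 2 * As t i j ^ 2 := by simp [mul_pow, mul_comm]
    _ ≤ τ * ∑ t, c t ^ 2 * Ts t i j ^ 2 :=
        mul_le_mul_of_nonneg_left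
          (sum_le_sum fun t _ => mul_le_mul_of_nonneg_left (hdom t i j) (sq_nonneg _))
          (Nat.cast_nonneg τ)

/-- Entries of a linear combination of matrices. [folklore] -/
private theorem sum_smul_apply (As : Fin τ → Matrix (Fin m) (Fin n) ℝ) (i : Fin m) (j : Fin n) :
    (∑ t, c t • As t) i j = ∑ t, c t * As t i j := by
  simp [Matrix.sum_apply, Matrix.smul_apply]

/-- **Mixture identity for the row-norm vector of `Ã`**: choosing `t` with probability
`∝ λ_t²‖Ã^{(t)}‖_F²` and then a row index `i ∼ 𝒟_{ã^{(t)}}` produces `i ∼ 𝒟_ã` exactly — the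
sampler behind `s_φ(A) = max_t s(A^{(t)}) + …` for the row-norm vector (valid when some
`λ_t Ã^{(t)} ≠ 0`). [cite: ChiaEtAl2022, §2.2 Lemma "linear combinations of matrices"] -/
theorem rowDist_mlinCombTilde_mixture (hS : ∑ t, c t ^ 2 * frobSq (Ts t) ≠ 0) (i : Fin m) :
    ∑ t, (c t ^ 2 * frobSq (Ts t) / ∑ u, c u ^ 2 * frobSq (Ts u)) * rowDist (Ts t) i =
      rowDist (mlinCombTilde Ts c) i := by
  have hτ : (τ : ℝ) ≠ 0 := by
    rintro hτ0
    apply hS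
    have : τ = 0 := by exact_mod_cast hτ0
    subst this
    simp
  have hterm : ∀ t, (c t ^ 2 * frobSq (Ts t) / ∑ u, c u ^ 2 * frobSq (Ts u)) * rowDist (Ts t) i =
      c t ^ 2 * normSq (Ts t i) / ∑ u, c u ^ 2 * frobSq (Ts u) := by
    intro t
    unfold rowDist
    rcases eq_or_ne (frobSq (Ts t)) 0 with h0 | h0
    · have hrow : normSq (Ts t i) = 0 :=
        le_antisymm (h0 ▸ Finset.single_le_sum (f := fun i => normSq (Ts t i))
          (fun i _ => normSq_nonneg _) (Finset.mem_univ i)) (normSq_nonneg _)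
      simp [h0, hrow]
    · field_simp
  simp_rw [hterm, ← Finset.sum_div]
  unfold rowDist
  rw [normSq_mlinCombTilde_row, frobSq_mlinCombTilde, mul_div_mul_left _ _ hτ]

/-- **Mixture identity for row `i` of `Ã`**: choosing `t` with probability `∝ λ_t²‖Ã^{(t)}(i,·)‖²`
and then `j ∼ 𝒟_{Ã^{(t)}(i,·)}` produces `j ∼ 𝒟_{Ã(i,·)}` exactly (valid when row `i` of some
`λ_t Ã^{(t)}` is nonzero). [cite: ChiaEtAl2022, §2.2 Lemma "linear combinations of matrices"] -/
theorem lengthSqDist_mlinCombTilde_row_mixture (i : Fin m)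
    (hS : ∑ t, c t ^ 2 * normSq (Ts t i) ≠ 0) (j : Fin n) :
    ∑ t, (c t ^ 2 * normSq (Ts t i) / ∑ u, c u ^ 2 * normSq (Ts u i)) * lengthSqDist (Ts t i) j =
      lengthSqDist (mlinCombTilde Ts c i) j := by
  have hτ : (τ : ℝ) ≠ 0 := by
    rintro hτ0
    apply hS
    have : τ = 0 := by exact_mod_cast hτ0
    subst this
    simp
  have hterm : ∀ t,
      (c t ^ 2 * normSq (Ts t i) / ∑ u, c u ^ 2 * normSq (Ts u i)) * lengthSqDist (Ts t i) j =
      c t ^ 2 * Ts t i j ^ 2 / ∑ u, c u ^ 2 * normSq (Ts u i) := by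
    intro t
    unfold lengthSqDist
    rcases eq_or_ne (normSq (Ts t i)) 0 with h0 | h0
    · have : Ts t i = 0 := (normSq_eq_zero_iff _).1 h0
      have hij : Ts t i j = 0 := by simpa using congrFun this j
      simp [h0, hij]
    · field_simp
  simp_rw [hterm, ← Finset.sum_div]
  unfold lengthSqDist
  rw [mlinCombTilde_sq, normSq_mlinCombTilde_row, mul_div_mul_left _ _ hτ]

end mlinComb

namespace MatrixOversamplingWitness

variable {τ : ℕ} {φs : Fin τ → ℝ} {As : Fin τ → Matrix (Fin m) (Fin n) ℝ}

/-- **Linear combinations of matrices.** Given `SQ_{φ^{(t)}}(A^{(t)})` for `t < τ` and scalars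
`λ_t`, one has `SQ_φ(Σ_t λ_t A^{(t)})` with `φ = τ (Σ_t φ^{(t)}‖λ_t A^{(t)}‖_F²)/‖Σ_t λ_t A^{(t)}‖_F²`;
the witness is `mlinCombTilde` (the hypothesis `Σ_t λ_t A^{(t)} ≠ 0` is the text's implicit
`‖A‖_F ≠ 0` in the denominator). [cite: ChiaEtAl2022, §2.2 Lemma "linear combinations of
matrices"] -/
def linComb (Ws : ∀ t, MatrixOversamplingWitness (φs t) (As t)) (c : Fin τ → ℝ)
    (hne : ∑ t, c t • As t ≠ 0) :
    MatrixOversamplingWitness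
      (τ * (∑ t, φs t * frobSq (c t • As t)) / frobSq (∑ t, c t • As t)) (∑ t, c t • As t) where
  tilde := mlinCombTilde (fun t => (Ws t).tilde) c
  frobSq_tilde := by
    have hS : ∑ t, φs t * frobSq (c t • As t) = ∑ t, c t ^ 2 * frobSq (Ws t).tilde := by
      refine sum_congr rfl fun t _ => ?_
      rw [frobSq_smul, (Ws t).frobSq_tilde]; ring
    rw [frobSq_mlinCombTilde, hS, div_mul_cancel₀ _ (frobSq_pos hne).ne']
  sq_le i j := by
    have : (∑ t, c t • As t) i j = ∑ t, c t * As t i j := by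
      simp [Matrix.sum_apply, Matrix.smul_apply]
    rw [this]
    exact sq_sum_le_mlinCombTilde_sq _ c As (fun t => (Ws t).sq_le) i j

/-- The witness of the linear-combination lemma is `mlinCombTilde`. [cite: ChiaEtAl2022, §2.2
Lemma "linear combinations of matrices"] -/
@[simp] theorem linComb_tilde (Ws : ∀ t, MatrixOversamplingWitness (φs t) (As t)) (c : Fin τ → ℝ)
    (hne : ∑ t, c t • As t ≠ 0) :
    (linComb Ws c hne).tilde = mlinCombTilde (fun t => (Ws t).tilde) c := rfl

end MatrixOversamplingWitness

/-! ### Remark 3.1: approximate closure of `SQ_φ` under matrix products -/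

section approxProduct

variable {s : ℕ} {φ₁ φ₂ : ℝ} {X : Matrix (Fin m) (Fin n) ℝ} {Y : Matrix (Fin m) (Fin q) ℝ}

/-- The sampling distribution of the Remark: `r = (p + q)/2` with `p = 𝒟_x̃`, `q = 𝒟_ỹ` the
row-norm distributions available under `SQ_{φ₁}(X)`, `SQ_{φ₂}(Y)`. [cite: ChiaEtAl2022, §3.2,
paragraph after Remark 3.1 ("taking `p = 𝒟_x̃` and `q = 𝒟_ỹ`")] -/
def avgDist (WX : MatrixOversamplingWitness φ₁ X) (WY : MatrixOversamplingWitness φ₂ Y)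
    (k : Fin m) : ℝ :=
  (rowDist WX.tilde k + rowDist WY.tilde k) / 2

variable (WX : MatrixOversamplingWitness φ₁ X) (WY : MatrixOversamplingWitness φ₂ Y)

/-- `r ≥ 0` when `X, Y ≠ 0`. [cite: ChiaEtAl2022, §3.2, paragraph after Remark 3.1] -/
theorem avgDist_nonneg (hX : X ≠ 0) (hY : Y ≠ 0) (k : Fin m) : 0 ≤ avgDist WX WY k := by
  have h1 := (WX.isOversampledDist_rowDist hX).nonneg k
  have h2 := (WY.isOversampledDist_rowDist hY).nonneg k
  unfold avgDist
  positivity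

/-- **`M := X†S†SY = (SX)ᵀ(SY)`**, the sketch `S` sampled according to `r` along `ω ∈ [m]^s`.
[cite: ChiaEtAl2022, §3.2, paragraph after Remark 3.1 ("thereby finding a desired
`M := X†S†SY`")] -/
def approxProd (ω : Fin s → Fin m) : Matrix (Fin n) (Fin q) ℝ :=
  (sketch (avgDist WX WY) ω * X)ᵀ * (sketch (avgDist WX WY) ω * Y)

/-- **`M̃`**, "a linear combination of outer products of rows of `X̃` with rows of `Ỹ`":
`M̃ := mlinCombTilde` of the `s` outer products `[SX̃](ℓ,·)[SỸ](ℓ,·)ᵀ` with coefficients `1`, so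
that `|M̃(i,j)|² = s Σ_ℓ |[SX̃](ℓ,i)[SỸ](ℓ,j)|²` (`approxProdTilde_sq`).
[cite: ChiaEtAl2022, §3.2, paragraph after Remark 3.1] -/
def approxProdTilde (ω : Fin s → Fin m) : Matrix (Fin n) (Fin q) ℝ :=
  mlinCombTilde
    (fun ℓ => Matrix.vecMulVec ((sketch (avgDist WX WY) ω * WX.tilde) ℓ)
      ((sketch (avgDist WX WY) ω * WY.tilde) ℓ))
    (fun _ => 1)

/-- The printed definition: `|M̃(i,j)|² = s Σ_{ℓ=1}^s |[SX̃](ℓ,i)†[SỸ](ℓ,j)|²`.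
[cite: ChiaEtAl2022, §3.2, paragraph after Remark 3.1] -/
theorem approxProdTilde_sq (ω : Fin s → Fin m) (i : Fin n) (j : Fin q) :
    approxProdTilde WX WY ω i j ^ 2 =
      s * ∑ ℓ, (sketch (avgDist WX WY) ω * WX.tilde) ℓ i ^ 2 *
        (sketch (avgDist WX WY) ω * WY.tilde) ℓ j ^ 2 := by
  unfold approxProdTilde
  rw [mlinCombTilde_sq]
  simp [vecMulVec_sq]

/-- **`M` is a linear combination of outer products**: `(SX)ᵀ(SY) = Σ_ℓ [SX](ℓ,·)[SY](ℓ,·)ᵀ`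
(coefficients `1`). [cite: ChiaEtAl2022, §3.2, paragraph after Remark 3.1 ("`M` is simply a
linear combination of outer products")] -/
theorem approxProd_eq_sum_vecMulVec (ω : Fin s → Fin m) :
    approxProd WX WY ω =
      ∑ ℓ, (1 : ℝ) • Matrix.vecMulVec ((sketch (avgDist WX WY) ω * X) ℓ)
        ((sketch (avgDist WX WY) ω * Y) ℓ) := by
  ext i j
  rw [approxProd, Matrix.mul_apply, Matrix.sum_apply]
  refine sum_congr rfl fun ℓ _ => ?_
  rw [Matrix.transpose_apply, Matrix.smul_apply, Matrix.vecMulVec_apply, smul_eq_mul, one_mul]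

/-- The sketched rows inherit the entrywise domination: `[SX](ℓ,i)² ≤ [SX̃](ℓ,i)²` (both are the
sampled row rescaled by the same `1/√(s r(k_ℓ))`). [cite: ChiaEtAl2022, §3.2, paragraph after
Remark 3.1, with Def. 2.9] -/
theorem sketch_mul_sq_le {p : Fin m → ℝ} {φ : ℝ} {A : Matrix (Fin m) (Fin n) ℝ}
    (W : MatrixOversamplingWitness φ A) (ω : Fin s → Fin m) (ℓ : Fin s) (i : Fin n) :
    (sketch p ω * A) ℓ i ^ 2 ≤ (sketch p ω * W.tilde) ℓ i ^ 2 := by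
  rw [sketch_mul_apply, sketch_mul_apply, div_pow, div_pow]
  exact div_le_div_of_nonneg_right (W.sq_le _ _) (sq_nonneg _)

/-- **`M̃` dominates `M` entrywise**: `|M(i,j)|² = |Σ_ℓ [SX](ℓ,i)[SY](ℓ,j)|² ≤
s Σ_ℓ |[SX̃](ℓ,i)|²|[SỸ](ℓ,j)|² = |M̃(i,j)|²` (Cauchy–Schwarz and the domination of the sketched
rows). [cite: ChiaEtAl2022, §3.2, paragraph after Remark 3.1 ("`SQ(M̃)` for `M̃` the
appropriate bound")] -/
theorem approxProd_sq_le (ω : Fin s → Fin m) (i : Fin n) (j : Fin q) :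
    approxProd WX WY ω i j ^ 2 ≤ approxProdTilde WX WY ω i j ^ 2 := by
  rw [approxProd_eq_sum_vecMulVec]
  have : (∑ ℓ, (1 : ℝ) • Matrix.vecMulVec ((sketch (avgDist WX WY) ω * X) ℓ)
        ((sketch (avgDist WX WY) ω * Y) ℓ)) i j =
      ∑ ℓ, (1 : ℝ) * Matrix.vecMulVec ((sketch (avgDist WX WY) ω * X) ℓ)
        ((sketch (avgDist WX WY) ω * Y) ℓ) i j := by
    simp [Matrix.sum_apply]
  rw [this]
  unfold approxProdTilde
  refine sq_sum_le_mlinCombTilde_sq _ _ _ (fun ℓ i' j' => ?_) i j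
  rw [vecMulVec_sq, vecMulVec_sq]
  exact mul_le_mul (sketch_mul_sq_le WX ω ℓ i') (sketch_mul_sq_le WY ω ℓ j') (sq_nonneg _)
    (sq_nonneg _)

/-- **First line of the displayed computation**: `‖M̃‖_F² = s Σ_ℓ ‖[SX̃](ℓ,·)‖²‖[SỸ](ℓ,·)‖²`.
[cite: ChiaEtAl2022, §3.2, display after Remark 3.1 (first equality)] -/
theorem frobSq_approxProdTilde (ω : Fin s → Fin m) :
    frobSq (approxProdTilde WX WY ω) =
      s * ∑ ℓ, normSq ((sketch (avgDist WX WY) ω * WX.tilde) ℓ) *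
        normSq ((sketch (avgDist WX WY) ω * WY.tilde) ℓ) := by
  unfold approxProdTilde
  rw [frobSq_mlinCombTilde]
  simp [frobSq_vecMulVec]

/-- **The AM–GM step, per sampled row `k = k_ℓ`**: with `r(k) = (‖X̃(k,·)‖²/‖X̃‖_F² +
‖Ỹ(k,·)‖²/‖Ỹ‖_F²)/2`,
`s‖[SX̃](ℓ,·)‖²‖[SỸ](ℓ,·)‖² = 4‖X̃(k,·)‖²‖Ỹ(k,·)‖²/(s (‖X̃(k,·)‖²/‖X̃‖_F² + ‖Ỹ(k,·)‖²/‖Ỹ‖_F²)²)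
≤ 4‖X̃(k,·)‖²‖Ỹ(k,·)‖²/(s (2‖X̃(k,·)‖‖Ỹ(k,·)‖/(‖X̃‖_F‖Ỹ‖_F))²) = ‖X̃‖_F²‖Ỹ‖_F²/s`.
[cite: ChiaEtAl2022, §3.2, display after Remark 3.1 (second and third lines)] -/
theorem sketch_row_term_le (hX : X ≠ 0) (hY : Y ≠ 0) (ω : Fin s → Fin m) (ℓ : Fin s) :
    s * (normSq ((sketch (avgDist WX WY) ω * WX.tilde) ℓ) *
        normSq ((sketch (avgDist WX WY) ω * WY.tilde) ℓ)) ≤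
      frobSq WX.tilde * frobSq WY.tilde / s := by
  have hs : (0 : ℝ) < s := Nat.cast_pos.2 (Fin.pos ℓ)
  have hr0 := avgDist_nonneg WX WY hX hY
  have hA : 0 < frobSq WX.tilde := WX.frobSq_tilde_pos hX
  have hB : 0 < frobSq WY.tilde := WY.frobSq_tilde_pos hY
  rw [normSq_sketch_mul_row hr0, normSq_sketch_mul_row hr0]
  set k := ω ℓ with hk
  set a := normSq (WX.tilde k) with ha
  set b := normSq (WY.tilde k) with hb
  set A := frobSq WX.tilde with hAdef
  set B := frobSq WY.tilde with hBdef
  have ha0 : 0 ≤ a := normSq_nonneg _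
  have hb0 : 0 ≤ b := normSq_nonneg _
  have hr : avgDist WX WY k = (a / A + b / B) / 2 := rfl
  -- degenerate rows: the term vanishes
  rcases ha0.eq_or_lt with ha' | ha'
  · rw [← ha']; simp only [zero_div, zero_mul, mul_zero]; positivity
  rcases hb0.eq_or_lt with hb' | hb'
  · rw [← hb']; simp only [zero_div, mul_zero]; positivity
  -- `r(k) > 0` and AM–GM: `(a/A)(b/B) ≤ r²`
  have hrpos : 0 < avgDist WX WY k := by rw [hr]; positivity
  have h4 : a / A * (b / B) ≤ avgDist WX WY k ^ 2 := by
    rw [hr]; nlinarith [sq_nonneg (a / A - b / B)]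
  have key : a * b ≤ A * B * avgDist WX WY k ^ 2 := by
    calc a * b = A * B * (a / A * (b / B)) := by field_simp
      _ ≤ A * B * avgDist WX WY k ^ 2 := mul_le_mul_of_nonneg_left h4 (by positivity)
  have hsr : 0 < (s : ℝ) * avgDist WX WY k := mul_pos hs hrpos
  rw [div_mul_div_comm, show (s : ℝ) * avgDist WX WY k * (s * avgDist WX WY k) =
      s * (s * avgDist WX WY k ^ 2) by ring, ← mul_div_assoc, div_le_div_iff₀ (by positivity) hs]
  calc s * (a * b) * s ≤ s * (A * B * avgDist WX WY k ^ 2) * s := by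
        have := mul_le_mul_of_nonneg_left key hs.le
        nlinarith
    _ = A * B * (s * (s * avgDist WX WY k ^ 2)) := by ring

/-- **`‖M̃‖_F² ≤ ‖X̃‖_F²‖Ỹ‖_F²`** (sum of the per-row AM–GM bounds over the `s` sampled rows; for
`s = 0` both sides are compared trivially). [cite: ChiaEtAl2022, §3.2, display after Remark 3.1
("`≤ … = ‖X̃‖_F²‖Ỹ‖_F²`")] -/
theorem frobSq_approxProdTilde_le (hX : X ≠ 0) (hY : Y ≠ 0) (ω : Fin s → Fin m) :
    frobSq (approxProdTilde WX WY ω) ≤ frobSq WX.tilde * frobSq WY.tilde := by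
  rw [frobSq_approxProdTilde, Finset.mul_sum]
  rcases Nat.eq_zero_or_pos s with hs | hs
  · subst hs
    simp only [Finset.univ_eq_empty, Finset.sum_empty]
    exact mul_nonneg (frobSq_nonneg _) (frobSq_nonneg _)
  · have hs' : (0 : ℝ) < s := Nat.cast_pos.2 hs
    calc ∑ ℓ, (s : ℝ) * (normSq ((sketch (avgDist WX WY) ω * WX.tilde) ℓ) *
            normSq ((sketch (avgDist WX WY) ω * WY.tilde) ℓ))
          ≤ ∑ _ℓ : Fin s, frobSq WX.tilde * frobSq WY.tilde / s :=
            sum_le_sum fun ℓ _ => sketch_row_term_le WX WY hX hY ω ℓ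
      _ = frobSq WX.tilde * frobSq WY.tilde := by
            rw [Finset.sum_const, Finset.card_univ, Fintype.card_fin, nsmul_eq_mul]
            field_simp

/-- **`‖M̃‖_F² ≤ φ₁φ₂‖X‖_F²‖Y‖_F²`** (last line of the display: `‖X̃‖_F²‖Ỹ‖_F² =
φ₁φ₂‖X‖_F²‖Y‖_F²`). [cite: ChiaEtAl2022, §3.2, display after Remark 3.1 (last equality)] -/
theorem frobSq_approxProdTilde_le' (hX : X ≠ 0) (hY : Y ≠ 0) (ω : Fin s → Fin m) :
    frobSq (approxProdTilde WX WY ω) ≤ φ₁ * φ₂ * frobSq X * frobSq Y := by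
  have h := frobSq_approxProdTilde_le WX WY hX hY ω
  rw [WX.frobSq_tilde, WY.frobSq_tilde] at h
  linarith

/-- **The witness of Remark 3.1**: for `M ≠ 0`, `M̃` gives `SQ_φ(M)` with `φ = ‖M̃‖_F²/‖M‖_F²`.
[cite: ChiaEtAl2022, §3.2 Remark 3.1] -/
def approxProdWitness (ω : Fin s → Fin m) (hM : approxProd WX WY ω ≠ 0) :
    MatrixOversamplingWitness (frobSq (approxProdTilde WX WY ω) / frobSq (approxProd WX WY ω))
      (approxProd WX WY ω) where
  tilde := approxProdTilde WX WY ω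
  frobSq_tilde := by rw [div_mul_cancel₀ _ (frobSq_pos hM).ne']
  sq_le := approxProd_sq_le WX WY ω

/-- The witness of Remark 3.1 is `M̃`. [cite: ChiaEtAl2022, §3.2 Remark 3.1] -/
@[simp] theorem approxProdWitness_tilde (ω : Fin s → Fin m) (hM : approxProd WX WY ω ≠ 0) :
    (approxProdWitness WX WY ω hM).tilde = approxProdTilde WX WY ω := rfl

/-- **`φ ≤ φ₁φ₂‖X‖_F²‖Y‖_F²/‖M‖_F²`.** [cite: ChiaEtAl2022, §3.2 Remark 3.1] -/
theorem approxProd_phi_le (hX : X ≠ 0) (hY : Y ≠ 0) (ω : Fin s → Fin m) :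
    frobSq (approxProdTilde WX WY ω) / frobSq (approxProd WX WY ω) ≤
      φ₁ * φ₂ * frobSq X * frobSq Y / frobSq (approxProd WX WY ω) :=
  div_le_div_of_nonneg_right (frobSq_approxProdTilde_le' WX WY hX hY ω) (frobSq_nonneg _)

/-! #### `SQ(M̃)`: the sampling structure of `M̃` -/

/-- A sketched row is a positive rescaling of the sampled row, so it has the same length-square
distribution: `𝒟_{[SÃ](ℓ,·)} = 𝒟_{Ã(k_ℓ,·)}` whenever `r(k_ℓ) > 0` — sampling from the rows of
`SX̃`, `SỸ` is sampling from rows of `X̃`, `Ỹ`. [cite: ChiaEtAl2022, §3.2, paragraph after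
Remark 3.1 ("outer products of rows of `X̃` with rows of `Ỹ`"), with Remark 2.13] -/
theorem lengthSqDist_sketch_mul_row {p : Fin m → ℝ} (A : Matrix (Fin m) (Fin n) ℝ)
    (ω : Fin s → Fin m) (ℓ : Fin s) (hp : 0 < p (ω ℓ)) :
    lengthSqDist ((sketch p ω * A) ℓ) = lengthSqDist (A (ω ℓ)) := by
  have hs : (0 : ℝ) < s := Nat.cast_pos.2 (Fin.pos ℓ)
  have hc : 1 / Real.sqrt (s * p (ω ℓ)) ≠ 0 :=
    one_div_ne_zero (Real.sqrt_pos.2 (mul_pos hs hp)).ne'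
  have hrow : (sketch p ω * A) ℓ = (1 / Real.sqrt (s * p (ω ℓ))) • A (ω ℓ) := by
    funext j
    rw [sketch_mul_apply, Pi.smul_apply, smul_eq_mul]
    ring
  rw [hrow, lengthSqDist_smul hc]

/-- **Sampling the row-norm vector of `M̃`**: choosing `ℓ` with probability
`∝ ‖[SX̃](ℓ,·)‖²‖[SỸ](ℓ,·)‖²` and then `i ∼ 𝒟_{[SX̃](ℓ,·)}` produces `i ∼ 𝒟_{m̃}` (`m̃` the
row-norm vector of `M̃`) exactly. [cite: ChiaEtAl2022, §3.2, paragraph after Remark 3.1 ("`SQ(M̃)`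
follows from the proofs of" the outer-product and linear-combination lemmas)] -/
theorem rowDist_approxProdTilde_mixture (ω : Fin s → Fin m)
    (hS : ∑ ℓ, normSq ((sketch (avgDist WX WY) ω * WX.tilde) ℓ) *
      normSq ((sketch (avgDist WX WY) ω * WY.tilde) ℓ) ≠ 0) (i : Fin n) :
    ∑ ℓ, (normSq ((sketch (avgDist WX WY) ω * WX.tilde) ℓ) *
          normSq ((sketch (avgDist WX WY) ω * WY.tilde) ℓ) /
        ∑ u, normSq ((sketch (avgDist WX WY) ω * WX.tilde) u) *
          normSq ((sketch (avgDist WX WY) ω * WY.tilde) u)) *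
      lengthSqDist ((sketch (avgDist WX WY) ω * WX.tilde) ℓ) i =
      rowDist (approxProdTilde WX WY ω) i := by
  unfold approxProdTilde
  have h := rowDist_mlinCombTilde_mixture
    (fun ℓ => Matrix.vecMulVec ((sketch (avgDist WX WY) ω * WX.tilde) ℓ)
      ((sketch (avgDist WX WY) ω * WY.tilde) ℓ)) (fun _ => (1 : ℝ))
    (by simpa [frobSq_vecMulVec] using hS) i
  rw [← h]
  refine sum_congr rfl fun ℓ _ => ?_
  simp only [one_pow, one_mul, frobSq_vecMulVec]
  rcases eq_or_ne ((sketch (avgDist WX WY) ω * WY.tilde) ℓ) 0 with h0 | h0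
  · rw [h0, (normSq_eq_zero_iff _).2 rfl]; simp
  · rw [rowDist_vecMulVec _ _ h0]

/-- **Sampling row `i` of `M̃`**: choosing `ℓ` with probability `∝ [SX̃](ℓ,i)²‖[SỸ](ℓ,·)‖²` and
then `j ∼ 𝒟_{[SỸ](ℓ,·)}` produces `j ∼ 𝒟_{M̃(i,·)}` exactly. [cite: ChiaEtAl2022, §3.2, paragraph
after Remark 3.1 ("`SQ(M̃)` follows from the proofs of" the outer-product and linear-combination
lemmas)] -/
theorem lengthSqDist_approxProdTilde_row_mixture (ω : Fin s → Fin m) (i : Fin n)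
    (hS : ∑ ℓ, (sketch (avgDist WX WY) ω * WX.tilde) ℓ i ^ 2 *
      normSq ((sketch (avgDist WX WY) ω * WY.tilde) ℓ) ≠ 0) (j : Fin q) :
    ∑ ℓ, ((sketch (avgDist WX WY) ω * WX.tilde) ℓ i ^ 2 *
          normSq ((sketch (avgDist WX WY) ω * WY.tilde) ℓ) /
        ∑ u, (sketch (avgDist WX WY) ω * WX.tilde) u i ^ 2 *
          normSq ((sketch (avgDist WX WY) ω * WY.tilde) u)) *
      lengthSqDist ((sketch (avgDist WX WY) ω * WY.tilde) ℓ) j =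
      lengthSqDist (approxProdTilde WX WY ω i) j := by
  unfold approxProdTilde
  have h := lengthSqDist_mlinCombTilde_row_mixture
    (fun ℓ => Matrix.vecMulVec ((sketch (avgDist WX WY) ω * WX.tilde) ℓ)
      ((sketch (avgDist WX WY) ω * WY.tilde) ℓ)) (fun _ => (1 : ℝ)) i
    (by simpa [normSq_vecMulVec_row] using hS) j
  rw [← h]
  refine sum_congr rfl fun ℓ _ => ?_
  simp only [one_pow, one_mul, normSq_vecMulVec_row]
  rcases eq_or_ne ((sketch (avgDist WX WY) ω * WX.tilde) ℓ i) 0 with h0 | h0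
  · rw [h0]; simp
  · rw [lengthSqDist_vecMulVec_row _ _ h0]

/-! #### Remark 3.1 assembled -/

/-- **Remark 3.1 (approximate closure of oversampling and query access under matrix products).**
Given `SQ_{φ₁}(X)` and `SQ_{φ₂}(Y)` (`X, Y ≠ 0`), sample `S ∈ ℝ^{s×m}` (`s ≥ 1`) according to
`r = (𝒟_x̃ + 𝒟_ỹ)/2` and put `M := (SX)ᵀ(SY)`, `M̃(i,j)² := s Σ_ℓ [SX̃](ℓ,i)²[SỸ](ℓ,j)²`.  Then for
every `δ > 0`: (i) [`M` is a sufficiently good approximation] the `r`-mass of the sample sequences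
with `‖M − XᵀY‖_F < √(8φ₁φ₂ log(2/δ)/s)‖X‖_F‖Y‖_F` exceeds `1 − δ` (the key lemma,
`approx_matrix_product'`, with `p = 𝒟_x̃`, `q = 𝒟_ỹ`); (ii) [`SQ_φ(M)`] for EVERY sample sequence,
`M̃` dominates `M` entrywise and `‖M̃‖_F² ≤ φ₁φ₂‖X‖_F²‖Y‖_F²`, i.e. `M̃` is a witness for `M` with
`φ = ‖M̃‖_F²/‖M‖_F² ≤ φ₁φ₂‖X‖_F²‖Y‖_F²/‖M‖_F²` (`approxProdWitness`, `approxProd_phi_le`).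
[cite: ChiaEtAl2022, §3.2 Remark 3.1 and the paragraph after it] -/
theorem approxProd_closure (hX : X ≠ 0) (hY : Y ≠ 0) (hs : 0 < s) {δ : ℝ} (hδ : 0 < δ) :
    (1 - δ < ∑ ω ∈ univ.filter (fun ω : Fin s → Fin m =>
        Real.sqrt (frobSq (approxProd WX WY ω - Xᵀ * Y)) <
          Real.sqrt (8 * φ₁ * φ₂ * Real.log (2 / δ) / s) *
            (Real.sqrt (frobSq X) * Real.sqrt (frobSq Y))),
      iidWeight (avgDist WX WY) ω) ∧
    ∀ ω : Fin s → Fin m,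
      (∀ i j, approxProd WX WY ω i j ^ 2 ≤ approxProdTilde WX WY ω i j ^ 2) ∧
        frobSq (approxProdTilde WX WY ω) ≤ φ₁ * φ₂ * frobSq X * frobSq Y := by
  refine ⟨?_, fun ω => ⟨approxProd_sq_le WX WY ω, frobSq_approxProdTilde_le' WX WY hX hY ω⟩⟩
  have h := approx_matrix_product' (WX.isOversampledDist_rowDist hX)
    (WY.isOversampledDist_rowDist hY) (WX.pos hX) (WY.pos hY) hX hY hs hδ
  exact h

end approxProduct

/-! ### Remark 2.10: "even" expressions `A†A` and `R†UR` decompositions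

> **Remark 2.10.** From the lemmas we've introduced, we can already get oversampling and query
> access to some modest expressions. […] Moreover, if we are willing to pay factors of `m` as
> well, we can write `A†A = Σ_{i=1}^m A(i,·)†A(i,·)`, and get `SQ_φ(A†A)` from `SQ(A)`, Lemma
> "outer products", and Lemma "linear combinations". We can generalize this to RUR
> decompositions, a decomposition occurring frequently in our results: suppose we have `SQ(A)` for
> `A ∈ ℂ^{m×n}`, `R ∈ ℂ^{r×n}` a (possibly normalized) subset of rows of `A`, and a matrix
> `U ∈ ℂ^{r×r}`. Then `R†UR = Σ_{i=1}^r Σ_{j=1}^r U(i,j) R(i,·)†R(j,·)`, which is a linear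
> combination of `r²` outer products involving rows of `A`. So, by Lemma "outer products" and
> Lemma "linear combinations", we have `SQ_φ(R†UR)`.

Both decompositions and the resulting witnesses, with the `φ` that the linear-combination lemma
yields (`τ = m`, resp. `τ = r²`, coefficients `1`, resp. `U(i,j)`, outer-product witnesses with
factor `1` for exactly known rows; more generally for rows known through dominating rows `R̃(i,·)`,
as when `R = SA` comes from `SQ_φ(A)` and `R̃ = SÃ`). -/

section rur

variable {r : ℕ}

/-- **`A†A = Σ_{i=1}^m A(i,·)†A(i,·)`** (`m` outer products of rows of `A`).
[cite: ChiaEtAl2022, §2.2 Remark 2.10] -/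
theorem transpose_mul_self_eq_sum_vecMulVec (A : Matrix (Fin m) (Fin n) ℝ) :
    Aᵀ * A = ∑ i, (1 : ℝ) • Matrix.vecMulVec (A i) (A i) := by
  ext a b
  simp only [Matrix.mul_apply, Matrix.transpose_apply, Matrix.sum_apply, Matrix.smul_apply,
    Matrix.vecMulVec_apply, smul_eq_mul, one_mul]

/-- **`R†UR = Σ_{i=1}^r Σ_{j=1}^r U(i,j) R(i,·)†R(j,·)`** ("a linear combination of `r²` outer
products involving rows of `A`"). [cite: ChiaEtAl2022, §2.2 Remark 2.10] -/
theorem transpose_mul_mul_eq_sum_vecMulVec (R : Matrix (Fin r) (Fin n) ℝ)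
    (U : Matrix (Fin r) (Fin r) ℝ) :
    Rᵀ * U * R = ∑ i, ∑ j, U i j • Matrix.vecMulVec (R i) (R j) := by
  ext a b
  simp only [Matrix.mul_apply, Matrix.transpose_apply, Matrix.sum_apply, Matrix.smul_apply,
    Matrix.vecMulVec_apply, smul_eq_mul, Finset.sum_mul]
  rw [Finset.sum_comm]
  exact Finset.sum_congr rfl fun i _ => Finset.sum_congr rfl fun j _ => by ring

/-- **`SQ_φ(A†A)` from (dominating rows of) `A`**: with rows dominated entrywise by `Ã(i,·)`, the
matrix `mlinCombTilde` of the `m` outer products `Ã(i,·)Ã(i,·)ᵀ` (coefficients `1`) is a witness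
for `AᵀA` with `φ = m Σ_i ‖Ã(i,·)‖⁴/‖AᵀA‖_F²` ("paying factors of `m`").
[cite: ChiaEtAl2022, §2.2 Remark 2.10] -/
def gramWitness (A At : Matrix (Fin m) (Fin n) ℝ) (hdom : ∀ i a, A i a ^ 2 ≤ At i a ^ 2)
    (hne : Aᵀ * A ≠ 0) :
    MatrixOversamplingWitness ((m : ℝ) * (∑ i, normSq (At i) ^ 2) / frobSq (Aᵀ * A)) (Aᵀ * A) where
  tilde := mlinCombTilde (fun i => Matrix.vecMulVec (At i) (At i)) (fun _ => 1)
  frobSq_tilde := by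
    rw [frobSq_mlinCombTilde, div_mul_cancel₀ _ (frobSq_pos hne).ne']
    congr 1
    exact sum_congr rfl fun i _ => by rw [frobSq_vecMulVec]; ring
  sq_le a b := by
    have h : (Aᵀ * A) a b = ∑ i, (1 : ℝ) * Matrix.vecMulVec (A i) (A i) a b := by
      rw [transpose_mul_self_eq_sum_vecMulVec]
      simp [Matrix.sum_apply]
    rw [h]
    refine sq_sum_le_mlinCombTilde_sq _ _ _ (fun i a' b' => ?_) a b
    rw [vecMulVec_sq, vecMulVec_sq]
    exact mul_le_mul (hdom i a') (hdom i b') (sq_nonneg _) (sq_nonneg _)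

/-- Enumeration of the `r²` index pairs `(i,j)` by `Fin (r·r)`. [folklore] -/
private def pairIdx (r : ℕ) : Fin (r * r) ≃ Fin r × Fin r := finProdFinEquiv.symm

/-- A double sum over `[r]×[r]` as a single sum over the `r²` enumerated pairs. [folklore] -/
private theorem sum_sum_eq_sum_pairIdx (f : Fin r → Fin r → ℝ) :
    ∑ i, ∑ j, f i j = ∑ k : Fin (r * r), f (pairIdx r k).1 (pairIdx r k).2 := by
  rw [Equiv.sum_comp (pairIdx r) (fun x : Fin r × Fin r => f x.1 x.2), Fintype.sum_prod_type]

/-- **`SQ_φ(R†UR)`**: with the rows of `R` dominated entrywise by those of `R̃` (`R̃ = R` for exactly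
known rows; `R̃ = SÃ` for `R = SA` under `SQ_φ(A)`), the matrix `mlinCombTilde` of the `r²` outer
products `R̃(i,·)R̃(j,·)ᵀ` with coefficients `U(i,j)` is a witness for `RᵀUR` with
`φ = r² (Σ_{i,j} U(i,j)² ‖R̃(i,·)‖²‖R̃(j,·)‖²)/‖RᵀUR‖_F²` — Lemma "outer products" + Lemma "linear
combinations of matrices" with `τ = r²`. [cite: ChiaEtAl2022, §2.2 Remark 2.10] -/
def rurWitness (R Rt : Matrix (Fin r) (Fin n) ℝ) (hdom : ∀ i a, R i a ^ 2 ≤ Rt i a ^ 2)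
    (U : Matrix (Fin r) (Fin r) ℝ) (hne : Rᵀ * U * R ≠ 0) :
    MatrixOversamplingWitness
      (((r * r : ℕ) : ℝ) * (∑ i, ∑ j, U i j ^ 2 * (normSq (Rt i) * normSq (Rt j))) /
        frobSq (Rᵀ * U * R))
      (Rᵀ * U * R) where
  tilde := mlinCombTilde (fun k => Matrix.vecMulVec (Rt (pairIdx r k).1) (Rt (pairIdx r k).2))
    (fun k => U (pairIdx r k).1 (pairIdx r k).2)
  frobSq_tilde := by
    rw [frobSq_mlinCombTilde, div_mul_cancel₀ _ (frobSq_pos hne).ne',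
      sum_sum_eq_sum_pairIdx (fun i j => U i j ^ 2 * (normSq (Rt i) * normSq (Rt j)))]
    congr 1
    exact sum_congr rfl fun k _ => by rw [frobSq_vecMulVec]
  sq_le a b := by
    have h : (Rᵀ * U * R) a b = ∑ k : Fin (r * r), U (pairIdx r k).1 (pairIdx r k).2 *
        Matrix.vecMulVec (R (pairIdx r k).1) (R (pairIdx r k).2) a b := by
      rw [transpose_mul_mul_eq_sum_vecMulVec]
      simp only [Matrix.sum_apply, Matrix.smul_apply, smul_eq_mul]
      exact sum_sum_eq_sum_pairIdx (fun i j => U i j * Matrix.vecMulVec (R i) (R j) a b)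
    rw [h]
    refine sq_sum_le_mlinCombTilde_sq _ _ _ (fun k a' b' => ?_) a b
    rw [vecMulVec_sq, vecMulVec_sq]
    exact mul_le_mul (hdom _ a') (hdom _ b') (sq_nonneg _) (sq_nonneg _)

/-- The printed `φ` in double-sum form: `‖(R†UR)~‖_F² = r² Σ_{i,j} U(i,j)² ‖R̃(i,·)‖²‖R̃(j,·)‖²`.
[cite: ChiaEtAl2022, §2.2 Remark 2.10 with Lemma "linear combinations of matrices"] -/
theorem frobSq_rurWitness_tilde (R Rt : Matrix (Fin r) (Fin n) ℝ)
    (hdom : ∀ i a, R i a ^ 2 ≤ Rt i a ^ 2) (U : Matrix (Fin r) (Fin r) ℝ) (hne : Rᵀ * U * R ≠ 0) :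
    frobSq (rurWitness R Rt hdom U hne).tilde =
      ((r * r : ℕ) : ℝ) * ∑ i, ∑ j, U i j ^ 2 * (normSq (Rt i) * normSq (Rt j)) := by
  rw [(rurWitness R Rt hdom U hne).frobSq_tilde, div_mul_cancel₀ _ (frobSq_pos hne).ne']

end rur

end SampleQuery

end Literature.Computability.QuantumComplexity

end
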